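import Summits.QuantumFields.QCD.Theorems.HeatSlicedQuarksTracedQuadraticParametrixFirstOrderTracedPairingAux

/-!
# Helpers (B) for stub `stub_firstOrderTracedPairing` of line `Sketch`
(crux `Summit.QuantumFields.QCD.Theses.HeatSlicedQuarks.TracedQuadraticParametrix`, item stmt-QuantumFields-17985)

The FIRST-ORDER traced term (`D₁` free Wilson–Dirac matrix, `K₁(σ) = e^{-σD₁ᴴD₁}`, `E = D_W(W) − D₁`, link
deficits `3 − Re tr W(z,μ) ≤ C_A (d(x,z)+1)² δ²`):
* `norm_colourTrace_hopping_le` — colour traces of the site–spin blocks of `E` are SECOND order,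
  `|Σ_a E((y,a,β),(y',a,β'))| ≤ 6 C_A δ² (d(x,y)+3)(d(x,y')+3) N(y,y')` (`hopping_apply` + the `SU(3)` trace
  inequality of the (A) file via `norm_trace_link_sub_one_le`, `norm_trace_link_inv_sub_one_le`);
* `sum_siteAdj_row/col`, `sum_sum_kernel_mul_mul_le` — the nearest-neighbour majorant `N` has row/column sums
  `8`; weighted Cauchy–Schwarz `Σ N F G ≤ 8 √(ΣF²) √(ΣG²)`;
* `norm_firstOrder_traced_le` / registered form `stub_firstOrderColourTracedTerm` — with the free column profiles
  and weighted moments as hypotheses, `|Σ_{a,α} ((D₁K₁(σ))ᴴ E K₁(τ))((x,a,α),(x,a,α))| ≤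
  3072 C_A C_F² M δ²/√((1+σ)(1+τ))`.  No named facts are used.
-/

noncomputable section

namespace Summit.QuantumFields.QCD.Cruxes.TracedQuadraticParametrix.Sketch

open Literature.MathematicalPhysics.QuantumLattice Literature.MathematicalPhysics.QuantumFieldTheory
  Literature.Probability.LatticeModels
open Summit.QuantumFields.QCD.Theses.HeatSlicedQuarks
open Summit.QuantumFields.QCD.Cruxes.SmallFieldUltracontractivity.PointCentredAxialParabolic
open Summit.QuantumFields.QCD.Theorems.SmallFieldUltracontractivity.Negative
open Summit.QuantumFields.QCD.Theorems.HeatSlicedQuarksDaviesGaffney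
open scoped Matrix ComplexConjugate

section HoppingTrace

variable {L : ℕ}

/-- The trace inequality for a link variable: `|tr (ρV − 1)| ≤ 6 (3 − Re tr ρV)` for `V ∈ SU(3)`. -/
theorem norm_trace_link_sub_one_le (V : SU3) :
    ‖(fundamentalRep (Fin 3) V - 1).trace‖ ≤ 6 * (3 - (fundamentalRep (Fin 3) V).trace.re) :=
  norm_trace_sub_one_le _ (fundamentalRep_unitary V) (Matrix.mem_specialUnitaryGroup_iff.mp V.2).2

/-- The same for the inverse link, `|tr (ρ(V⁻¹) − 1)| ≤ 6 (3 − Re tr ρV)` (`ρ(V⁻¹) = (ρV)ᴴ`, and the trace of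
the conjugate transpose is the conjugate). -/
theorem norm_trace_link_inv_sub_one_le (V : SU3) :
    ‖(fundamentalRep (Fin 3) V⁻¹ - 1).trace‖ ≤ 6 * (3 - (fundamentalRep (Fin 3) V).trace.re) := by
  rw [← star_rep_eq_rep_inv _ fundamentalRep_unitary V, Matrix.star_eq_conjTranspose,
    ← Matrix.conjTranspose_one, ← Matrix.conjTranspose_sub, Matrix.trace_conjTranspose, norm_star]
  exact norm_trace_link_sub_one_le V

variable [NeZero L]

/-- Neighbouring sites are at comparable distance from any centre: if `t = s + μ̂` then
`d(x,s) ≤ d(x,t) + 1` and `d(x,t) ≤ d(x,s) + 1`. -/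
theorem torusDist_le_of_eq_shift (x : TorusSite 4 L) {s t : TorusSite 4 L} {μ : Fin 4}
    (h : t = Site.shift s μ) : torusDist x s ≤ torusDist x t + 1 ∧ torusDist x t ≤ torusDist x s + 1 := by
  have h1 : torusDist t s ≤ 1 := by rw [h]; exact torusDist_shift_self_le s μ
  have h1' : torusDist s t ≤ 1 := by rw [h]; exact torusDist_self_shift_le s μ
  have h2 := torusDist_triangle' x t s
  have h3 := torusDist_triangle' x s t
  omega

/-- The comb weight of a link between neighbours: if `d(x,s) ≤ d(x,t) + 1` then
`C_A (d(x,s)+1)² δ² ≤ C_A δ² (d(x,s)+3)(d(x,t)+3)`. -/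
theorem linkWeight_le {C_A δ : ℝ} (hCA : 0 ≤ C_A) {ds dt : ℕ} (h : ds ≤ dt + 1) :
    C_A * ((ds : ℝ) + 1) ^ 2 * δ ^ 2 ≤ C_A * δ ^ 2 * (((ds : ℝ) + 3) * ((dt : ℝ) + 3)) := by
  have h' : (ds : ℝ) ≤ dt + 1 := by exact_mod_cast h
  have hds : (0 : ℝ) ≤ ds := Nat.cast_nonneg ds
  have hdt : (0 : ℝ) ≤ dt := Nat.cast_nonneg dt
  have hsq : ((ds : ℝ) + 1) ^ 2 ≤ ((ds : ℝ) + 3) * ((dt : ℝ) + 3) := by nlinarith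
  have := mul_le_mul_of_nonneg_left hsq (mul_nonneg hCA (sq_nonneg δ))
  linarith [this]

/-- **Colour traces of the hopping blocks are second order.**  For the hopping perturbation
`E = D_W(W) − D_W(1)` of a field with link deficits `3 − Re tr W(z,μ) ≤ C_A (d(x,z)+1)² δ²`, the colour
trace of every site–spin block is bounded by
`|Σ_a E((y,a,β),(y',a,β'))| ≤ 6 C_A δ² (d(x,y)+3)(d(x,y')+3) N(y,y')`,
`N(y,y') = Σ_μ ([y' = y+μ̂] + [y = y'+μ̂])` (entry formula `hopping_apply`, `|(1 ∓ γ_μ)_{ββ'}| ≤ 2`, and the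
`SU(3)` trace inequality for the blocks `ρW − 1`, `ρ(W⁻¹) − 1`). -/
theorem norm_colourTrace_hopping_le (W : GaugeConfig 4 L SU3) (m : ℝ) (x : TorusSite 4 L) {C_A δ : ℝ}
    (hCA : 0 ≤ C_A)
    (hdef : ∀ (z : TorusSite 4 L) (μ : Fin 4),
      3 - ((fundamentalRep (Fin 3)) (W (z, μ))).trace.re ≤ C_A * ((torusDist x z : ℝ) + 1) ^ 2 * δ ^ 2)
    (y : TorusSite 4 L) (β : Fin 4) (y' : TorusSite 4 L) (β' : Fin 4) :
    ‖∑ a : Fin 3, (wilsonDirac (fundamentalRep (Fin 3)) W m 1 -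
        wilsonDirac (fundamentalRep (Fin 3)) (freeCfg L) m 1) (y, a, β) (y', a, β')‖ ≤
      6 * C_A * δ ^ 2 * (((torusDist x y : ℝ) + 3) * ((torusDist x y' : ℝ) + 3)) *
        ∑ μ : Fin 4, ((if y' = Site.shift y μ then (1 : ℝ) else 0) +
          (if y = Site.shift y' μ then (1 : ℝ) else 0)) := by
  set Pw : ℝ := ((torusDist x y : ℝ) + 3) * ((torusDist x y' : ℝ) + 3) with hPw
  -- the entry formula, summed over the colour index
  have hsum : ∑ a : Fin 3, (wilsonDirac (fundamentalRep (Fin 3)) W m 1 -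
      wilsonDirac (fundamentalRep (Fin 3)) (freeCfg L) m 1) (y, a, β) (y', a, β') =
      -(1 / 2 : ℂ) * ∑ μ : Fin 4, ((if y' = Site.shift y μ then
          (((1 : ℝ) : ℂ) • (1 : Matrix (Fin 4) (Fin 4) ℂ) - euclideanGamma μ) β β' *
            (fundamentalRep (Fin 3) (W (y, μ)) - 1).trace else 0) +
        (if y = Site.shift y' μ then
          (((1 : ℝ) : ℂ) • (1 : Matrix (Fin 4) (Fin 4) ℂ) + euclideanGamma μ) β β' *
            (fundamentalRep (Fin 3) (W (y', μ))⁻¹ - 1).trace else 0)) := by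
    simp_rw [hopping_apply W m]
    rw [← Finset.mul_sum, Finset.sum_comm]
    congr 1
    refine Finset.sum_congr rfl fun μ _ => ?_
    rw [Finset.sum_add_distrib, Finset.sum_ite_irrel, Finset.sum_ite_irrel, Finset.sum_const_zero,
      ← Finset.mul_sum, ← Finset.mul_sum]
    rfl
  rw [hsum, norm_mul, norm_neg, show ‖(1 / 2 : ℂ)‖ = 1 / 2 by simp, Finset.mul_sum]
  -- termwise
  have hkey : ∀ μ : Fin 4, ‖(if y' = Site.shift y μ then
          (((1 : ℝ) : ℂ) • (1 : Matrix (Fin 4) (Fin 4) ℂ) - euclideanGamma μ) β β' *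
            (fundamentalRep (Fin 3) (W (y, μ)) - 1).trace else 0) +
        (if y = Site.shift y' μ then
          (((1 : ℝ) : ℂ) • (1 : Matrix (Fin 4) (Fin 4) ℂ) + euclideanGamma μ) β β' *
            (fundamentalRep (Fin 3) (W (y', μ))⁻¹ - 1).trace else 0)‖ ≤
      2 * (6 * C_A * δ ^ 2 * Pw * ((if y' = Site.shift y μ then (1 : ℝ) else 0) +
          (if y = Site.shift y' μ then (1 : ℝ) else 0))) := by
    intro μ
    refine (norm_add_le _ _).trans ?_
    rw [mul_add, mul_add]
    refine add_le_add ?_ ?_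
    · split_ifs with h
      · rw [norm_mul]
        have hd := (torusDist_le_of_eq_shift x h).1
        have h1 := norm_one_sub_gamma_apply_le_two μ β β'
        have h2 := (norm_trace_link_sub_one_le (W (y, μ))).trans
          (mul_le_mul_of_nonneg_left ((hdef y μ).trans (linkWeight_le (δ := δ) hCA hd)) (by norm_num))
        calc _ ≤ 2 * (6 * (C_A * δ ^ 2 * Pw)) := mul_le_mul h1 h2 (norm_nonneg _) (by norm_num)
          _ = _ := by ring
      · simp
    · split_ifs with h
      · rw [norm_mul]
        have hd := (torusDist_le_of_eq_shift x h).1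
        have h1 := norm_one_add_gamma_apply_le_two μ β β'
        have h2 := (norm_trace_link_inv_sub_one_le (W (y', μ))).trans
          (mul_le_mul_of_nonneg_left ((hdef y' μ).trans (linkWeight_le (δ := δ) hCA hd)) (by norm_num))
        calc _ ≤ 2 * (6 * (C_A * δ ^ 2 * (((torusDist x y' : ℝ) + 3) * ((torusDist x y : ℝ) + 3)))) :=
              mul_le_mul h1 h2 (norm_nonneg _) (by norm_num)
          _ = _ := by rw [hPw]; ring
      · simp
  calc 1 / 2 * ‖∑ μ : Fin 4, ((if y' = Site.shift y μ then
          (((1 : ℝ) : ℂ) • (1 : Matrix (Fin 4) (Fin 4) ℂ) - euclideanGamma μ) β β' *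
            (fundamentalRep (Fin 3) (W (y, μ)) - 1).trace else 0) +
        (if y = Site.shift y' μ then
          (((1 : ℝ) : ℂ) • (1 : Matrix (Fin 4) (Fin 4) ℂ) + euclideanGamma μ) β β' *
            (fundamentalRep (Fin 3) (W (y', μ))⁻¹ - 1).trace else 0))‖
      ≤ 1 / 2 * ∑ μ : Fin 4, 2 * (6 * C_A * δ ^ 2 * Pw * ((if y' = Site.shift y μ then (1 : ℝ) else 0) +
          (if y = Site.shift y' μ then (1 : ℝ) else 0))) :=
        mul_le_mul_of_nonneg_left ((norm_sum_le _ _).trans (Finset.sum_le_sum fun μ _ => hkey μ))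
          (by norm_num)
    _ = _ := by rw [← Finset.mul_sum, ← Finset.mul_sum]; ring

end HoppingTrace

section Schur

variable {L : ℕ} [NeZero L]

/-- Row sums of the site-level nearest-neighbour majorant `N(y,y') = Σ_μ ([y' = y+μ̂] + [y = y'+μ̂])`:
`Σ_{y'} N(y,y') = 8`. -/
theorem sum_siteAdj_row (y : TorusSite 4 L) :
    ∑ y' : TorusSite 4 L, ∑ μ : Fin 4, ((if y' = Site.shift y μ then (1 : ℝ) else 0) +
      (if y = Site.shift y' μ then (1 : ℝ) else 0)) = 8 := by
  rw [Finset.sum_comm]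
  simp only [Finset.sum_add_distrib, Finset.sum_ite_eq', Finset.mem_univ, if_true]
  have he : ∀ (μ : Fin 4) (y' : TorusSite 4 L), (y = Site.shift y' μ) = (y' = y - Pi.single μ 1) :=
    fun μ y' => propext (eq_shift_iff y y' μ)
  simp only [he, Finset.sum_ite_eq', Finset.mem_univ, if_true, Finset.sum_const, Finset.card_univ,
    Fintype.card_fin, nsmul_eq_mul]
  norm_num

/-- Column sums of the site-level nearest-neighbour majorant: `Σ_y N(y,y') = 8`. -/
theorem sum_siteAdj_col (y' : TorusSite 4 L) :
    ∑ y : TorusSite 4 L, ∑ μ : Fin 4, ((if y' = Site.shift y μ then (1 : ℝ) else 0) +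
      (if y = Site.shift y' μ then (1 : ℝ) else 0)) = 8 := by
  rw [← sum_siteAdj_row y']
  exact Finset.sum_congr rfl fun y _ => Finset.sum_congr rfl fun μ _ => add_comm _ _

omit [NeZero L] in
/-- **Weighted Cauchy–Schwarz (Schur) for a nonnegative kernel** with row and column sums `≤ R`:
`Σ_{y'} Σ_y N(y,y') F(y) G(y') ≤ R √(Σ F²) √(Σ G²)` for nonnegative `F, G`. -/
theorem sum_sum_kernel_mul_mul_le {S : Type*} [Fintype S] (N : S → S → ℝ) (F G : S → ℝ) {R : ℝ}
    (hR : 0 ≤ R) (hN : ∀ y y', 0 ≤ N y y') (hF : ∀ y, 0 ≤ F y) (hG : ∀ y, 0 ≤ G y)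
    (hrow : ∀ y, ∑ y', N y y' ≤ R) (hcol : ∀ y', ∑ y, N y y' ≤ R) :
    ∑ y', ∑ y, N y y' * F y * G y' ≤ R * Real.sqrt (∑ y, F y ^ 2) * Real.sqrt (∑ y', G y' ^ 2) := by
  have hpair : ∑ y', ∑ y, N y y' * F y * G y' = ∑ p : S × S, N p.2 p.1 * F p.2 * G p.1 :=
    (Fintype.sum_prod_type (fun p : S × S => N p.2 p.1 * F p.2 * G p.1)).symm
  have hsq : (∑ p : S × S, N p.2 p.1 * F p.2 * G p.1) ^ 2 ≤
      (∑ p : S × S, N p.2 p.1 * F p.2 ^ 2) * (∑ p : S × S, N p.2 p.1 * G p.1 ^ 2) :=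
    Finset.sum_sq_le_sum_mul_sum_of_sq_le_mul Finset.univ (fun p _ => mul_nonneg (hN _ _) (sq_nonneg _))
      (fun p _ => mul_nonneg (hN _ _) (sq_nonneg _)) (fun p _ => le_of_eq (by ring))
  have h1 : ∑ p : S × S, N p.2 p.1 * F p.2 ^ 2 ≤ R * ∑ y, F y ^ 2 := by
    rw [Fintype.sum_prod_type, Finset.sum_comm, Finset.mul_sum]
    refine Finset.sum_le_sum fun y _ => ?_
    dsimp only
    rw [← Finset.sum_mul]
    exact mul_le_mul_of_nonneg_right (hrow y) (sq_nonneg _)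
  have h2 : ∑ p : S × S, N p.2 p.1 * G p.1 ^ 2 ≤ R * ∑ y', G y' ^ 2 := by
    rw [Fintype.sum_prod_type, Finset.mul_sum]
    refine Finset.sum_le_sum fun y' _ => ?_
    dsimp only
    rw [← Finset.sum_mul]
    exact mul_le_mul_of_nonneg_right (hcol y') (sq_nonneg _)
  have hNG0 : 0 ≤ ∑ p : S × S, N p.2 p.1 * G p.1 ^ 2 :=
    Finset.sum_nonneg fun p _ => mul_nonneg (hN _ _) (sq_nonneg _)
  have hL0 : 0 ≤ ∑ p : S × S, N p.2 p.1 * F p.2 * G p.1 :=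
    Finset.sum_nonneg fun p _ => mul_nonneg (mul_nonneg (hN _ _) (hF _)) (hG _)
  have hA0 : 0 ≤ ∑ y, F y ^ 2 := Finset.sum_nonneg fun _ _ => sq_nonneg _
  have hB0 : 0 ≤ ∑ y', G y' ^ 2 := Finset.sum_nonneg fun _ _ => sq_nonneg _
  have hNF0 : 0 ≤ ∑ p : S × S, N p.2 p.1 * F p.2 ^ 2 :=
    Finset.sum_nonneg fun p _ => mul_nonneg (hN _ _) (sq_nonneg _)
  rw [hpair]
  have key : (∑ p : S × S, N p.2 p.1 * F p.2 * G p.1) ^ 2 ≤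
      (R * Real.sqrt (∑ y, F y ^ 2) * Real.sqrt (∑ y', G y' ^ 2)) ^ 2 :=
    calc (∑ p : S × S, N p.2 p.1 * F p.2 * G p.1) ^ 2
        ≤ (∑ p : S × S, N p.2 p.1 * F p.2 ^ 2) * (∑ p : S × S, N p.2 p.1 * G p.1 ^ 2) := hsq
      _ ≤ (R * ∑ y, F y ^ 2) * (R * ∑ y', G y' ^ 2) := mul_le_mul h1 h2 hNG0 (mul_nonneg hR hA0)
      _ = (R * Real.sqrt (∑ y, F y ^ 2) * Real.sqrt (∑ y', G y' ^ 2)) ^ 2 := by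
          rw [mul_pow, mul_pow, Real.sq_sqrt hA0, Real.sq_sqrt hB0]; ring
  exact (sq_le_sq₀ hL0 (by positivity)).mp key

end Schur

section FirstOrder

variable {L : ℕ} [NeZero L]

/-- `√(M/(1+σ)) √(M/(1+τ)) = M/√((1+σ)(1+τ))` for `M, σ, τ ≥ 0`. -/
theorem sqrt_div_mul_sqrt_div {M σ τ : ℝ} (hM : 0 ≤ M) (hσ : 0 ≤ σ) (hτ : 0 ≤ τ) :
    Real.sqrt (M / (1 + σ)) * Real.sqrt (M / (1 + τ)) = M / Real.sqrt ((1 + σ) * (1 + τ)) := by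
  have h1 : 0 < 1 + σ := by linarith
  have h2 : 0 < 1 + τ := by linarith
  rw [← Real.sqrt_mul (div_nonneg hM h1.le), div_mul_div_comm, Real.sqrt_div' _ (by positivity),
    Real.sqrt_mul_self hM]

/-- **The first-order traced term is second order.**  With `D₁` the free Wilson–Dirac matrix,
`K(σ) = e^{-σD₁ᴴD₁}`, `E = D_W(W) − D₁`: given the free profiles of the columns `(D₁K(σ))(·,(x,0,α))`,
`K(τ)(·,(x,0,α))` and the two weighted moments, the colour–spin trace at `x` of `(D₁K(σ))ᴴ E K(τ)` is
`≤ 3072 C_A C_F² M δ²/√((1+σ)(1+τ))` (colour trace formula + `norm_colourTrace_hopping_le` + the weighted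
Cauchy–Schwarz with the nearest-neighbour majorant). -/
theorem norm_firstOrder_traced_le (W : GaugeConfig 4 L SU3) (m : ℝ) (x : TorusSite 4 L)
    {C_A δ C_F M σ τ : ℝ} (hCA : 0 ≤ C_A) (hM : 0 ≤ M) (hσ : 0 ≤ σ) (hτ : 0 ≤ τ)
    (hdef : ∀ (z : TorusSite 4 L) (μ : Fin 4),
      3 - ((fundamentalRep (Fin 3)) (W (z, μ))).trace.re ≤ C_A * ((torusDist x z : ℝ) + 1) ^ 2 * δ ^ 2)
    (hDK : ∀ (z : TorusSite 4 L) (β α : Fin 4),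
      ‖(wilsonDirac (fundamentalRep (Fin 3)) (freeCfg L) m 1 *
          NormedSpace.exp (-(σ : ℂ) • ((wilsonDirac (fundamentalRep (Fin 3)) (freeCfg L) m 1)ᴴ *
            wilsonDirac (fundamentalRep (Fin 3)) (freeCfg L) m 1))) (z, 0, β) (x, 0, α)‖ ≤
        C_F * (Real.sqrt (1 + σ) / (1 + σ + (torusDist x z : ℝ) ^ 2) ^ 3))
    (hK : ∀ (z : TorusSite 4 L) (β α : Fin 4),
      ‖(NormedSpace.exp (-(τ : ℂ) • ((wilsonDirac (fundamentalRep (Fin 3)) (freeCfg L) m 1)ᴴ *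
            wilsonDirac (fundamentalRep (Fin 3)) (freeCfg L) m 1))) (z, 0, β) (x, 0, α)‖ ≤
        C_F * ((1 + τ) / (1 + τ + (torusDist x z : ℝ) ^ 2) ^ 3))
    (hMσ : ∑ z : TorusSite 4 L, ((torusDist x z : ℝ) + 3) ^ 2 *
        (Real.sqrt (1 + σ) / (1 + σ + (torusDist x z : ℝ) ^ 2) ^ 3) ^ 2 ≤ M / (1 + σ))
    (hMτ : ∑ z : TorusSite 4 L, ((torusDist x z : ℝ) + 3) ^ 2 *
        ((1 + τ) / (1 + τ + (torusDist x z : ℝ) ^ 2) ^ 3) ^ 2 ≤ M / (1 + τ)) :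
    ‖∑ a : Fin 3, ∑ α : Fin 4,
        ((wilsonDirac (fundamentalRep (Fin 3)) (freeCfg L) m 1 *
            NormedSpace.exp (-(σ : ℂ) • ((wilsonDirac (fundamentalRep (Fin 3)) (freeCfg L) m 1)ᴴ *
              wilsonDirac (fundamentalRep (Fin 3)) (freeCfg L) m 1)))ᴴ *
          (wilsonDirac (fundamentalRep (Fin 3)) W m 1 - wilsonDirac (fundamentalRep (Fin 3)) (freeCfg L) m 1) *
          NormedSpace.exp (-(τ : ℂ) • ((wilsonDirac (fundamentalRep (Fin 3)) (freeCfg L) m 1)ᴴ *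
            wilsonDirac (fundamentalRep (Fin 3)) (freeCfg L) m 1))) (x, a, α) (x, a, α)‖ ≤
      3072 * C_A * C_F ^ 2 * M * δ ^ 2 / Real.sqrt ((1 + σ) * (1 + τ)) := by
  set D₁ : Matrix (TorusSite 4 L × Fin 3 × Fin 4) (TorusSite 4 L × Fin 3 × Fin 4) ℂ :=
    wilsonDirac (fundamentalRep (Fin 3)) (freeCfg L) m 1 with hD₁
  set E : Matrix (TorusSite 4 L × Fin 3 × Fin 4) (TorusSite 4 L × Fin 3 × Fin 4) ℂ :=
    wilsonDirac (fundamentalRep (Fin 3)) W m 1 - D₁ with hE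
  set Kσ : Matrix (TorusSite 4 L × Fin 3 × Fin 4) (TorusSite 4 L × Fin 3 × Fin 4) ℂ :=
    NormedSpace.exp (-(σ : ℂ) • (D₁ᴴ * D₁)) with hKσ
  set Kτ : Matrix (TorusSite 4 L × Fin 3 × Fin 4) (TorusSite 4 L × Fin 3 × Fin 4) ℂ :=
    NormedSpace.exp (-(τ : ℂ) • (D₁ᴴ * D₁)) with hKτ
  -- colour structure of the two kernel columns
  have hA : ∀ (α : Fin 4) (y : TorusSite 4 L) (c : Fin 3) (β : Fin 4) (a : Fin 3),
      (D₁ * Kσ) (y, c, β) (x, a, α) = if c = a then (D₁ * Kσ) (y, 0, β) (x, 0, α) else 0 :=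
    fun α y c β a => colour_mul D₁ Kσ (wilsonDirac_freeCfg_colour m) (freeKernel_colour m σ) y c β x a α
  have hB : ∀ (α : Fin 4) (y : TorusSite 4 L) (c : Fin 3) (β : Fin 4) (a : Fin 3),
      Kτ (y, c, β) (x, a, α) = if c = a then Kτ (y, 0, β) (x, 0, α) else 0 :=
    fun α y c β a => freeKernel_colour m τ y c β x a α
  -- the nearest-neighbour majorant and the colour-trace bound of the hopping blocks
  set N : TorusSite 4 L → TorusSite 4 L → ℝ := fun y y' => ∑ μ : Fin 4,
    ((if y' = Site.shift y μ then (1 : ℝ) else 0) + (if y = Site.shift y' μ then (1 : ℝ) else 0)) with hN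
  have hX : ∀ (y : TorusSite 4 L) (β : Fin 4) (y' : TorusSite 4 L) (β' : Fin 4),
      ‖∑ a : Fin 3, E (y, a, β) (y', a, β')‖ ≤
        6 * C_A * δ ^ 2 * (((torusDist x y : ℝ) + 3) * ((torusDist x y' : ℝ) + 3)) * N y y' :=
    fun y β y' β' => norm_colourTrace_hopping_le W m x hCA hdef y β y' β'
  -- the two weighted profiles and the weighted Cauchy–Schwarz
  set F : TorusSite 4 L → ℝ := fun y =>
    ((torusDist x y : ℝ) + 3) * (Real.sqrt (1 + σ) / (1 + σ + (torusDist x y : ℝ) ^ 2) ^ 3) with hF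
  set G : TorusSite 4 L → ℝ := fun y =>
    ((torusDist x y : ℝ) + 3) * ((1 + τ) / (1 + τ + (torusDist x y : ℝ) ^ 2) ^ 3) with hG
  have hF0 : ∀ y, 0 ≤ F y := fun y => by positivity
  have hG0 : ∀ y, 0 ≤ G y := fun y => by positivity
  have hN0 : ∀ y y', 0 ≤ N y y' := fun y y' => Finset.sum_nonneg fun μ _ => by positivity
  have hCS : ∑ y', ∑ y, N y y' * F y * G y' ≤ 8 * Real.sqrt (∑ y, F y ^ 2) * Real.sqrt (∑ y', G y' ^ 2) :=
    sum_sum_kernel_mul_mul_le N F G (by norm_num) hN0 hF0 hG0 (fun y => (sum_siteAdj_row y).le)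
      (fun y' => (sum_siteAdj_col y').le)
  have hsF : Real.sqrt (∑ y, F y ^ 2) ≤ Real.sqrt (M / (1 + σ)) := by
    refine Real.sqrt_le_sqrt (le_trans (le_of_eq (Finset.sum_congr rfl fun y _ => ?_)) hMσ)
    rw [hF, mul_pow]
  have hsG : Real.sqrt (∑ y', G y' ^ 2) ≤ Real.sqrt (M / (1 + τ)) := by
    refine Real.sqrt_le_sqrt (le_trans (le_of_eq (Finset.sum_congr rfl fun y _ => ?_)) hMτ)
    rw [hG, mul_pow]
  have hprod : Real.sqrt (∑ y, F y ^ 2) * Real.sqrt (∑ y', G y' ^ 2) ≤ M / Real.sqrt ((1 + σ) * (1 + τ)) := by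
    rw [← sqrt_div_mul_sqrt_div hM hσ hτ]
    exact mul_le_mul hsF hsG (Real.sqrt_nonneg _) (Real.sqrt_nonneg _)
  -- the bound for each spin index
  have hα : ∀ α : Fin 4, ‖∑ a : Fin 3, ((D₁ * Kσ)ᴴ * E * Kτ) (x, a, α) (x, a, α)‖ ≤
      768 * C_A * C_F ^ 2 * M * δ ^ 2 / Real.sqrt ((1 + σ) * (1 + τ)) := by
    intro α
    have h1 := norm_sum_conjTranspose_mul_mul_apply_le (D₁ * Kσ) E Kτ x α
      (fun y β => (D₁ * Kσ) (y, 0, β) (x, 0, α)) (fun y β => Kτ (y, 0, β) (x, 0, α))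
      (fun y => C_F * (Real.sqrt (1 + σ) / (1 + σ + (torusDist x y : ℝ) ^ 2) ^ 3))
      (fun y => C_F * ((1 + τ) / (1 + τ + (torusDist x y : ℝ) ^ 2) ^ 3))
      (fun y y' => 6 * C_A * δ ^ 2 * (((torusDist x y : ℝ) + 3) * ((torusDist x y' : ℝ) + 3)) * N y y')
      (hA α) (hB α) (fun y β => hDK y β α) (fun y β => hK y β α) hX
    refine h1.trans ?_
    have hrw : ∑ y' : TorusSite 4 L, ∑ y : TorusSite 4 L,
        C_F * (Real.sqrt (1 + σ) / (1 + σ + (torusDist x y : ℝ) ^ 2) ^ 3) *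
          (C_F * ((1 + τ) / (1 + τ + (torusDist x y' : ℝ) ^ 2) ^ 3)) *
          (6 * C_A * δ ^ 2 * (((torusDist x y : ℝ) + 3) * ((torusDist x y' : ℝ) + 3)) * N y y') =
        6 * C_A * δ ^ 2 * C_F ^ 2 * ∑ y', ∑ y, N y y' * F y * G y' := by
      rw [Finset.mul_sum]
      refine Finset.sum_congr rfl fun y' _ => ?_
      rw [Finset.mul_sum]
      refine Finset.sum_congr rfl fun y _ => ?_
      rw [hF, hG]
      ring
    rw [hrw]
    have hc0 : 0 ≤ 6 * C_A * δ ^ 2 * C_F ^ 2 := by positivity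
    calc 16 * (6 * C_A * δ ^ 2 * C_F ^ 2 * ∑ y', ∑ y, N y y' * F y * G y')
        ≤ 16 * (6 * C_A * δ ^ 2 * C_F ^ 2 * (8 * (M / Real.sqrt ((1 + σ) * (1 + τ))))) := by
          refine mul_le_mul_of_nonneg_left (mul_le_mul_of_nonneg_left (hCS.trans ?_) hc0) (by norm_num)
          rw [mul_assoc]
          exact mul_le_mul_of_nonneg_left hprod (by norm_num)
      _ = 768 * C_A * C_F ^ 2 * M * δ ^ 2 / Real.sqrt ((1 + σ) * (1 + τ)) := by ring
  -- sum over the spin index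
  rw [Finset.sum_comm]
  calc ‖∑ α : Fin 4, ∑ a : Fin 3, ((D₁ * Kσ)ᴴ * E * Kτ) (x, a, α) (x, a, α)‖
      ≤ ∑ α : Fin 4, ‖∑ a : Fin 3, ((D₁ * Kσ)ᴴ * E * Kτ) (x, a, α) (x, a, α)‖ := norm_sum_le _ _
    _ ≤ ∑ _α : Fin 4, 768 * C_A * C_F ^ 2 * M * δ ^ 2 / Real.sqrt ((1 + σ) * (1 + τ)) :=
        Finset.sum_le_sum fun α _ => hα α
    _ = 3072 * C_A * C_F ^ 2 * M * δ ^ 2 / Real.sqrt ((1 + σ) * (1 + τ)) := by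
        simp only [Finset.sum_const, Finset.card_univ, Fintype.card_fin, nsmul_eq_mul]
        ring

/-- **Registered form (stub `stub_firstOrderColourTracedTerm` of the crux item)** of
`norm_firstOrder_traced_le`: the colour–spin trace at `x` of the first-order term `(D₁K₁(σ))ᴴ E K₁(τ)` is
`≤ 3072 C_A C_F² M δ²/√((1+σ)(1+τ))`, given the link-deficit profile, the free column profiles with constant
`C_F` and the two weighted moments with constant `M ≥ 0`. -/
theorem stub_firstOrderColourTracedTerm :
    ∀ (L : ℕ) [NeZero L] (W : GaugeConfig 4 L (Matrix.specialUnitaryGroup (Fin 3) ℂ)) (m : ℝ)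
    (x : TorusSite 4 L) (C_A δ C_F M σ τ : ℝ), 0 ≤ C_A → 0 ≤ M → 0 ≤ σ → 0 ≤ τ →
    (∀ (z : TorusSite 4 L) (μ : Fin 4),
      3 - ((fundamentalRep (Fin 3)) (W (z, μ))).trace.re ≤ C_A * ((torusDist x z : ℝ) + 1) ^ 2 * δ ^ 2) →
    (∀ (z : TorusSite 4 L) (β α : Fin 4),
      ‖(wilsonDirac (fundamentalRep (Fin 3)) (fun _ : Edge 4 L => (1 : Matrix.specialUnitaryGroup (Fin 3) ℂ)) m 1 *
          NormedSpace.exp (-(σ : ℂ) •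
            ((wilsonDirac (fundamentalRep (Fin 3))
                (fun _ : Edge 4 L => (1 : Matrix.specialUnitaryGroup (Fin 3) ℂ)) m 1)ᴴ *
              wilsonDirac (fundamentalRep (Fin 3))
                (fun _ : Edge 4 L => (1 : Matrix.specialUnitaryGroup (Fin 3) ℂ)) m 1)))
        (z, 0, β) (x, 0, α)‖ ≤ C_F * (Real.sqrt (1 + σ) / (1 + σ + (torusDist x z : ℝ) ^ 2) ^ 3)) →
    (∀ (z : TorusSite 4 L) (β α : Fin 4),
      ‖(NormedSpace.exp (-(τ : ℂ) •
            ((wilsonDirac (fundamentalRep (Fin 3))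
                (fun _ : Edge 4 L => (1 : Matrix.specialUnitaryGroup (Fin 3) ℂ)) m 1)ᴴ *
              wilsonDirac (fundamentalRep (Fin 3))
                (fun _ : Edge 4 L => (1 : Matrix.specialUnitaryGroup (Fin 3) ℂ)) m 1)))
        (z, 0, β) (x, 0, α)‖ ≤ C_F * ((1 + τ) / (1 + τ + (torusDist x z : ℝ) ^ 2) ^ 3)) →
    (∑ z : TorusSite 4 L, ((torusDist x z : ℝ) + 3) ^ 2 *
        (Real.sqrt (1 + σ) / (1 + σ + (torusDist x z : ℝ) ^ 2) ^ 3) ^ 2 ≤ M / (1 + σ)) →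
    (∑ z : TorusSite 4 L, ((torusDist x z : ℝ) + 3) ^ 2 *
        ((1 + τ) / (1 + τ + (torusDist x z : ℝ) ^ 2) ^ 3) ^ 2 ≤ M / (1 + τ)) →
    ‖∑ a : Fin 3, ∑ α : Fin 4,
        ((wilsonDirac (fundamentalRep (Fin 3)) (fun _ : Edge 4 L => (1 : Matrix.specialUnitaryGroup (Fin 3) ℂ)) m 1 *
            NormedSpace.exp (-(σ : ℂ) •
              ((wilsonDirac (fundamentalRep (Fin 3))
                  (fun _ : Edge 4 L => (1 : Matrix.specialUnitaryGroup (Fin 3) ℂ)) m 1)ᴴ *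
                wilsonDirac (fundamentalRep (Fin 3))
                  (fun _ : Edge 4 L => (1 : Matrix.specialUnitaryGroup (Fin 3) ℂ)) m 1)))ᴴ *
          (wilsonDirac (fundamentalRep (Fin 3)) W m 1 -
            wilsonDirac (fundamentalRep (Fin 3)) (fun _ : Edge 4 L => (1 : Matrix.specialUnitaryGroup (Fin 3) ℂ)) m 1) *
          NormedSpace.exp (-(τ : ℂ) •
            ((wilsonDirac (fundamentalRep (Fin 3))
                (fun _ : Edge 4 L => (1 : Matrix.specialUnitaryGroup (Fin 3) ℂ)) m 1)ᴴ *
              wilsonDirac (fundamentalRep (Fin 3))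
                (fun _ : Edge 4 L => (1 : Matrix.specialUnitaryGroup (Fin 3) ℂ)) m 1)))
        (x, a, α) (x, a, α)‖ ≤
      3072 * C_A * C_F ^ 2 * M * δ ^ 2 / Real.sqrt ((1 + σ) * (1 + τ)) :=
  fun _ _ W m x _ _ _ _ _ _ hCA hM hσ hτ hdef hDK hK hMσ hMτ =>
    norm_firstOrder_traced_le W m x hCA hM hσ hτ hdef hDK hK hMσ hMτ

end FirstOrder

end Summit.QuantumFields.QCD.Cruxes.TracedQuadraticParametrix.Sketch

end
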